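import Summits.BirchSwinnertonDyer.BirchSwinnertonDyer.Theorems.GoldfeldAllTwistsTwoConverseTwinAdditiveTwoAdicPlusPFive
import HarnessLib

set_option linter.dupNamespace false -- namespace `…BirchSwinnertonDyer.BirchSwinnertonDyer…` is the cell's (D-0017 nested layout)
set_option autoImplicit false

/-!
# B5⁺ tranche F_β⁺, file Fβ⁺-0b: `…TwinAdditiveTwoAdicThreeModEightPFive` — the `2`-adic kills of the classes `p, 7p ∈ S(−42qp, 448q²p²)` on
# `(q, p) ≡ (3, 5) (mod 8)` (TYPE-FREE, `(p/q)`-free)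

Cell `bsd-goldfeld`, seat `bsd-goldfeld-s1p-c3x` (gen 16); planner ORDER (cccxciii) «OBJECT B5⁺», tranche F_β⁺ (kill table `scoping/kills_b35_plus.txt`: on b35+
the classes `p, 7p` of `S(W)` die at `2` and at `p`, the classes `2p, 14p` at `q` only). The `(3, 5)` companion of D⁺-0′ `…TwinAdditiveTwoAdicPlusPFive`
(`(7, 5)`): the rescaling is `p ↦ 5` (common factor, `5p ≡ 1 (8)`) and `q ↦ 3` (square factor, `3q ≡ 1 (8)`), giving the numerics `(−630; 5, 20160)` and
`(−630; 35, 2880)`. `--supports stmt-BirchSwinnertonDyer-19140` as a HELPER. Theses-free; theorems only; no definition, no fact binder, no `sorry`.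
FRONTIER-grade: a twist-density-ZERO sub-family; never distance-to-summit.

* §1 Two numeric kills: `w² = 5u⁴ − 630u²z² + 20160z⁴` and `w² = 35u⁴ − 630u²z² + 2880z⁴` have no non-trivial `ℚ₂`-point — all keys modulo `8`
  (`decide`); the deep charts halve three times (`20160 → 5040 → 1260 → 315`, `2880 → 720 → 180 → 45`, engine `padicInt_two_sq_ne_of_descend`) and
  end on charts decided modulo `8`.
* §2 The rescaled class kills on `(q, p) ≡ (3, 5) (mod 8)`: classes `p, 7p` of `S(−42qp, 448q²p²)`.
HONEST FRAMING: local lemmas only; no Selmer group is bounded in this file; items 19140 / 19350 / 20044 unchanged; BSD is not proved by any of this.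

References: [SilvermanAEC2009] Prop. X.4.9, Example X.4.10; [Serre1973] Ch. II §3.3 Thm 4.
-/

noncomputable section

open scoped Classical

open WeierstrassCurve Literature.NumberTheory.EllipticCurves

namespace Summit.BirchSwinnertonDyer.BirchSwinnertonDyer.Theorems.GoldfeldGoodTwists

/-! ## §1 Two numeric `ℚ₂`-kills (all keys modulo `8`) -/

section NumericThreeFive

/-- `ℤ/8` keys, shallow charts: `S² ≠ 5 − 630T² + 20160T⁴` and `S² ≠ 35 − 630T² + 2880T⁴`. [folklore] -/
theorem keys_shallow_threeModEightPFive :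
    (∀ T S : ZMod (2 ^ 3), S ^ 2 ≠ ((5 : ℤ) : ZMod (2 ^ 3)) + ((-630 : ℤ) : ZMod (2 ^ 3)) * T ^ 2 + ((20160 : ℤ) : ZMod (2 ^ 3)) * T ^ 4) ∧
    (∀ T S : ZMod (2 ^ 3), S ^ 2 ≠ ((35 : ℤ) : ZMod (2 ^ 3)) + ((-630 : ℤ) : ZMod (2 ^ 3)) * T ^ 2 + ((2880 : ℤ) : ZMod (2 ^ 3)) * T ^ 4) := by
  refine ⟨?_, ?_⟩ <;> decide

/-- `ℤ/8` keys for the deep chart of `(−630; 5, 20160)`: odd-`T` keys at `20160, 5040, 1260` (with `5, 20, 80`) and the full key at `(315; 320)`. [folklore] -/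
theorem keys_deep_five_threeModEightPFive :
    (∀ T S : ZMod (2 ^ 3), S ^ 2 ≠ ((20160 : ℤ) : ZMod (2 ^ 3)) + ((-630 : ℤ) : ZMod (2 ^ 3)) * (2 * T + 1) ^ 2 +
      ((5 : ℤ) : ZMod (2 ^ 3)) * (2 * T + 1) ^ 4) ∧
    (∀ T S : ZMod (2 ^ 3), S ^ 2 ≠ ((5040 : ℤ) : ZMod (2 ^ 3)) + ((-630 : ℤ) : ZMod (2 ^ 3)) * (2 * T + 1) ^ 2 +
      ((4 * 5 : ℤ) : ZMod (2 ^ 3)) * (2 * T + 1) ^ 4) ∧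
    (∀ T S : ZMod (2 ^ 3), S ^ 2 ≠ ((1260 : ℤ) : ZMod (2 ^ 3)) + ((-630 : ℤ) : ZMod (2 ^ 3)) * (2 * T + 1) ^ 2 +
      ((4 * (4 * 5) : ℤ) : ZMod (2 ^ 3)) * (2 * T + 1) ^ 4) ∧
    (∀ T S : ZMod (2 ^ 3), S ^ 2 ≠ ((315 : ℤ) : ZMod (2 ^ 3)) + ((-630 : ℤ) : ZMod (2 ^ 3)) * T ^ 2 +
      ((4 * (4 * (4 * 5)) : ℤ) : ZMod (2 ^ 3)) * T ^ 4) := by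
  refine ⟨?_, ?_, ?_, ?_⟩ <;> decide

/-- `ℤ/8` keys for the deep chart of `(−630; 35, 2880)`: odd-`T` keys at `2880, 720, 180` (with `35, 140, 560`) and the full key at `(45; 2240)`. [folklore] -/
theorem keys_deep_thirtyFive_threeModEightPFive :
    (∀ T S : ZMod (2 ^ 3), S ^ 2 ≠ ((2880 : ℤ) : ZMod (2 ^ 3)) + ((-630 : ℤ) : ZMod (2 ^ 3)) * (2 * T + 1) ^ 2 +
      ((35 : ℤ) : ZMod (2 ^ 3)) * (2 * T + 1) ^ 4) ∧
    (∀ T S : ZMod (2 ^ 3), S ^ 2 ≠ ((720 : ℤ) : ZMod (2 ^ 3)) + ((-630 : ℤ) : ZMod (2 ^ 3)) * (2 * T + 1) ^ 2 +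
      ((4 * 35 : ℤ) : ZMod (2 ^ 3)) * (2 * T + 1) ^ 4) ∧
    (∀ T S : ZMod (2 ^ 3), S ^ 2 ≠ ((180 : ℤ) : ZMod (2 ^ 3)) + ((-630 : ℤ) : ZMod (2 ^ 3)) * (2 * T + 1) ^ 2 +
      ((4 * (4 * 35) : ℤ) : ZMod (2 ^ 3)) * (2 * T + 1) ^ 4) ∧
    (∀ T S : ZMod (2 ^ 3), S ^ 2 ≠ ((45 : ℤ) : ZMod (2 ^ 3)) + ((-630 : ℤ) : ZMod (2 ^ 3)) * T ^ 2 +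
      ((4 * (4 * (4 * 35)) : ℤ) : ZMod (2 ^ 3)) * T ^ 4) := by
  refine ⟨?_, ?_, ?_, ?_⟩ <;> decide

/-- Shallow chart of `(−630; 5, 20160)` in `ℤ₂`. [folklore] -/
theorem chart_five_threeModEightPFive (t s : ℤ_[2]) :
    s ^ 2 ≠ ((5 : ℤ) : ℤ_[2]) + ((-630 : ℤ) : ℤ_[2]) * t ^ 2 + ((20160 : ℤ) : ℤ_[2]) * t ^ 4 :=
  padicInt_two_sq_ne_of_zmodPow 3 keys_shallow_threeModEightPFive.1 t s

/-- Shallow chart of `(−630; 35, 2880)` in `ℤ₂`. [folklore] -/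
theorem chart_thirtyFive_threeModEightPFive (t s : ℤ_[2]) :
    s ^ 2 ≠ ((35 : ℤ) : ℤ_[2]) + ((-630 : ℤ) : ℤ_[2]) * t ^ 2 + ((2880 : ℤ) : ℤ_[2]) * t ^ 4 :=
  padicInt_two_sq_ne_of_zmodPow 3 keys_shallow_threeModEightPFive.2 t s

/-- **`w² = 5u⁴ − 630u²z² + 20160z⁴` has no non-trivial `ℚ₂`-point** (shallow chart mod `8`; deep chart halves `20160 → 5040 → 1260 → 315`, then mod `8`).
[cite: SilvermanAEC2009, Prop. X.4.9 and Example X.4.10] -/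
theorem not_isSoluble_two_numeric_five_threeModEightPFive : ¬ ((twoIsogenyQuartic (-630) 5 20160).map (Int.castRingHom ℚ_[2])).IsSoluble := by
  obtain ⟨k1, k2, k3, k4⟩ := keys_deep_five_threeModEightPFive
  refine not_isSoluble_two_of_padicInt_charts chart_five_threeModEightPFive ?_
  refine padicInt_two_sq_ne_of_descend 5040 3 (by norm_num) k1 ?_
  refine padicInt_two_sq_ne_of_descend 1260 3 (by norm_num) k2 ?_
  refine padicInt_two_sq_ne_of_descend 315 3 (by norm_num) k3 ?_
  exact padicInt_two_sq_ne_of_zmodPow 3 k4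

/-- **`w² = 35u⁴ − 630u²z² + 2880z⁴` has no non-trivial `ℚ₂`-point** (shallow chart mod `8`; deep chart halves `2880 → 720 → 180 → 45`, then mod `8`).
[cite: SilvermanAEC2009, Prop. X.4.9 and Example X.4.10] -/
theorem not_isSoluble_two_numeric_thirtyFive_threeModEightPFive : ¬ ((twoIsogenyQuartic (-630) 35 2880).map (Int.castRingHom ℚ_[2])).IsSoluble := by
  obtain ⟨k1, k2, k3, k4⟩ := keys_deep_thirtyFive_threeModEightPFive
  refine not_isSoluble_two_of_padicInt_charts chart_thirtyFive_threeModEightPFive ?_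
  refine padicInt_two_sq_ne_of_descend 720 3 (by norm_num) k1 ?_
  refine padicInt_two_sq_ne_of_descend 180 3 (by norm_num) k2 ?_
  refine padicInt_two_sq_ne_of_descend 45 3 (by norm_num) k3 ?_
  exact padicInt_two_sq_ne_of_zmodPow 3 k4

end NumericThreeFive

/-! ## §2 The class kills `p, 7p ∈ S(−42qp, 448q²p²)` at `2` on `(q, p) ≡ (3, 5) (mod 8)` -/

section ClassesThreeFive
variable {q p : ℕ}

/-- **Class `p ∈ S(−42qp, 448q²p²)` dies at `2`** (`q ≡ 3 (8)`, `p ≡ 5 (8)`): `p ↦ 5` (common factor, `5p ≡ 1 (8)`), `q ↦ 3` (square factor, `3q ≡ 1 (8)`)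
give §1's numeric `(−630; 5, 20160)`. [cite: SilvermanAEC2009, Prop. X.4.9 and Example X.4.10] [cite: Serre1973, Ch. II §3.3 Thm 4] -/
theorem not_isSoluble_two_class_P_threeModEightPFive (hq8 : q % 8 = 3) (hp8 : p % 8 = 5) {a d d' : ℤ} (ha : a = -42 * ((q : ℤ) * p))
    (hd : d = (p : ℤ) * 1) (hd' : d' = (p : ℤ) * (448 * (q : ℤ) ^ 2)) : ¬ ((twoIsogenyQuartic a d d').map (Int.castRingHom ℚ_[2])).IsSoluble :=
  fun h ↦ by
  have h1 := isSoluble_two_of_common_factor (n := p) (n₀ := 5) (by omega) (a₀ := -42 * (q : ℤ)) (d₀ := 1) (e₀ := 448 * (q : ℤ) ^ 2)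
    (by rw [ha]; ring) (by rw [hd]) (by rw [hd']) h
  have h2 := isSoluble_two_of_sq_factor (n := q) (n₀ := 3) (by omega) (a₁ := 5 * (-42)) (d := 5 * 1) (e₁ := 5 * 448)
    (by ring) (by ring) h1
  norm_num at h2
  exact not_isSoluble_two_numeric_five_threeModEightPFive h2

/-- **Class `7p ∈ S(−42qp, 448q²p²)` dies at `2`** (`q ≡ 3 (8)`, `p ≡ 5 (8)`): rescaled to §1's numeric `(−630; 35, 2880)`.
[cite: SilvermanAEC2009, Prop. X.4.9 and Example X.4.10] [cite: Serre1973, Ch. II §3.3 Thm 4] -/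
theorem not_isSoluble_two_class_sevenP_threeModEightPFive (hq8 : q % 8 = 3) (hp8 : p % 8 = 5) {a d d' : ℤ} (ha : a = -42 * ((q : ℤ) * p))
    (hd : d = (p : ℤ) * 7) (hd' : d' = (p : ℤ) * (64 * (q : ℤ) ^ 2)) : ¬ ((twoIsogenyQuartic a d d').map (Int.castRingHom ℚ_[2])).IsSoluble :=
  fun h ↦ by
  have h1 := isSoluble_two_of_common_factor (n := p) (n₀ := 5) (by omega) (a₀ := -42 * (q : ℤ)) (d₀ := 7) (e₀ := 64 * (q : ℤ) ^ 2)
    (by rw [ha]; ring) (by rw [hd]) (by rw [hd']) h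
  have h2 := isSoluble_two_of_sq_factor (n := q) (n₀ := 3) (by omega) (a₁ := 5 * (-42)) (d := 5 * 7) (e₁ := 5 * 64)
    (by ring) (by ring) h1
  norm_num at h2
  exact not_isSoluble_two_numeric_thirtyFive_threeModEightPFive h2

end ClassesThreeFive

end Summit.BirchSwinnertonDyer.BirchSwinnertonDyer.Theorems.GoldfeldGoodTwists

end
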